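import Mathlib
import Summits.ValiantsHypothesis.ValiantsHypothesis.Theses.BinomialElusive
import Summits.ValiantsHypothesis.ValiantsHypothesis.Theorems.BinomialElusiveRazTransferCircuit
import Summits.ValiantsHypothesis.ValiantsHypothesis.Theorems.BinomialElusiveRazTransferWitness
import Literature.Computability.AlgebraicComplexity.RazElusiveGeneralDischarge

/-!
# `RazTransfer` (stmt-ValiantsHypothesis-8497) — the bridge from the binomial candidate to
`per ∉ VP_ℂ`, by Raz's theorem

Route `BinomialElusive` of `ValiantsHypothesis`. `RazTransfer` says: if for all large `m` the
binomial curve `f_m : ℂ → ℂ^m`, `f_{m,i}(x) = x^{E(2i+1)} + x^{E(2i+2)}`,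
`E(j) = Σ_{k ≤ h} (j (2m+2)^{h+1})^k`, `h = ⌊log₂ m⌋²`, eludes every quadratic
`Γ : ℂ^{m-1} → ℂ^m`, then the permanent family over `ℂ` is not in `VP`. Proof (known
mathematics; Raz 2010, abstract and §1 result 1, PROVED in the tree as
`Raz2010_elusive_curve_holds`): re-index by Raz's basic parameter `n` with
`m(n) = 2^{⌊log₂ n⌋²}` (`mFn`, part 1; `m ≥ n^{ω(1)}`, `mFn_growth`), view the curve in
`ℂ[x]` (`curve`, part 1), check its degree is `< 2ⁿ` eventually (`totalDegree_curve_lt`), convert the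
hypothesis into `IsElusive (curve n) (m n - 1) 2` (`isElusive_curve`), and prove the
multilinearised family poly(`n`)-definable (`isPolyDefinableMap_curve`) by Valiant's criterion
for mappings (`isPolyDefinableMap_of_cktSize`, part 2) applied to the exponent-bit circuit
(`cktSize_lowBits_expo`, part 1). Then `Raz2010_elusive_curve.not_isVPFamily_complex` concludes.

References: R. Raz, *Elusive functions and lower bounds for arithmetic circuits*, Theory of
Computing 6 (2010) 135–177 (abstract; §1 result 1; Prop. 1.2; Def. 1.3); P. Bürgisser,
*Completeness and Reduction in Algebraic Complexity Theory* (2000), Prop. 2.20; L. G. Valiant,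
*Completeness classes in algebra*, STOC 1979.
-/

set_option linter.dupNamespace false

noncomputable section

namespace Summit.ValiantsHypothesis.ValiantsHypothesis.Theorems.BinomialElusiveRazTransfer

open MvPolynomial Literature.Computability.AlgebraicComplexity Literature.Computability.Complexity

/-! ### The re-indexing `m(n) = 2^{⌊log₂ n⌋²}` -/

/-- `⌊log₂ m(n)⌋ = ⌊log₂ n⌋²`. -/
theorem log_mFn (n : ℕ) : Nat.log 2 (mFn n) = Nat.log 2 n ^ 2 := Nat.log_pow (by norm_num) _

/-- **`m(n) ≥ n^{ω(1)}`**: for every `c`, `n^c ≤ m(n)` for all large `n`. -/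
theorem mFn_growth (c : ℕ) : ∃ n₀ : ℕ, ∀ n ≥ n₀, n ^ c ≤ mFn n := by
  refine ⟨2 ^ (c + 1), fun n hn => ?_⟩
  have hL : c + 1 ≤ Nat.log 2 n := Nat.le_log_of_pow_le (by norm_num) hn
  have hn' : n < 2 ^ (Nat.log 2 n + 1) := Nat.lt_pow_succ_log_self (by norm_num) n
  calc n ^ c ≤ (2 ^ (Nat.log 2 n + 1)) ^ c := Nat.pow_le_pow_left hn'.le c
    _ = 2 ^ ((Nat.log 2 n + 1) * c) := by rw [← pow_mul]
    _ ≤ 2 ^ (Nat.log 2 n ^ 2) := Nat.pow_le_pow_right (by norm_num) (by nlinarith)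

/-! ### The curve family and its degree -/

/-- `E_m(j) < (2m+2)^{(h+2)(h+1)}` for `1 ≤ j ≤ 2m` (`h = ⌊log₂ m⌋²`): a geometric sum in
`y = j (2m+2)^{h+1} ≥ 2` is `< y^{h+1}`. -/
theorem expo_lt (m j : ℕ) (hj1 : 1 ≤ j) (hj : j ≤ 2 * m) :
    expo m j < (2 * m + 2) ^ ((Nat.log 2 m ^ 2 + 2) * (Nat.log 2 m ^ 2 + 1)) := by
  set h := Nat.log 2 m ^ 2 with hh
  have hB : 2 ≤ (2 * m + 2) ^ (h + 1) :=
    le_trans (by omega) (Nat.le_self_pow (Nat.succ_ne_zero h) (2 * m + 2))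
  have hy : 2 ≤ j * (2 * m + 2) ^ (h + 1) :=
    le_trans hB (Nat.le_mul_of_pos_left _ hj1)
  unfold expo
  rw [← hh]
  calc ∑ k ∈ Finset.range (h + 1), (j * (2 * m + 2) ^ (h + 1)) ^ k
      < (j * (2 * m + 2) ^ (h + 1)) ^ (h + 1) :=
        Nat.geomSum_lt hy fun k hk => Finset.mem_range.1 hk
    _ ≤ ((2 * m + 2) * (2 * m + 2) ^ (h + 1)) ^ (h + 1) := by
        gcongr
        omega
    _ = (2 * m + 2) ^ ((h + 2) * (h + 1)) := by
        rw [← pow_succ', pow_mul]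

/-- A polylogarithmic exponent is eventually below `n`: for all large `n`,
`(L²+2)(L⁴+2)(L⁴+1) < n` with `L = ⌊log₂ n⌋`. -/
theorem eventually_polylog_lt :
    ∃ n₀ : ℕ, ∀ n ≥ n₀,
      (Nat.log 2 n ^ 2 + 2) * ((Nat.log 2 n ^ 4 + 2) * (Nat.log 2 n ^ 4 + 1)) < n := by
  obtain ⟨T, hT⟩ := eventually_mul_pow_lt_two_pow 10 18
  refine ⟨2 ^ max T 1, fun n hn => ?_⟩
  have hn1 : 1 ≤ n := le_trans Nat.one_le_two_pow hn
  have hL : max T 1 ≤ Nat.log 2 n := Nat.le_log_of_pow_le (by norm_num) hn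
  set L := Nat.log 2 n with hLdef
  have hL1 : 1 ≤ L := le_trans (le_max_right _ _) hL
  have h18 : (L ^ 2 + 2) * ((L ^ 4 + 2) * (L ^ 4 + 1)) ≤ 18 * L ^ 10 := by
    have h2 : L ^ 2 + 2 ≤ 3 * L ^ 2 := by nlinarith [Nat.one_le_pow 2 L hL1]
    have h4 : L ^ 4 + 2 ≤ 3 * L ^ 4 := by nlinarith [Nat.one_le_pow 4 L hL1]
    have h4' : L ^ 4 + 1 ≤ 2 * L ^ 4 := by nlinarith [Nat.one_le_pow 4 L hL1]
    calc (L ^ 2 + 2) * ((L ^ 4 + 2) * (L ^ 4 + 1)) ≤ (3 * L ^ 2) * ((3 * L ^ 4) * (2 * L ^ 4)) :=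
          Nat.mul_le_mul h2 (Nat.mul_le_mul h4 h4')
      _ = 18 * L ^ 10 := by ring
  calc (L ^ 2 + 2) * ((L ^ 4 + 2) * (L ^ 4 + 1)) ≤ 18 * L ^ 10 := h18
    _ < 2 ^ L := hT L (le_trans (le_max_left _ _) hL)
    _ ≤ n := by rw [hLdef]; exact Nat.pow_log_le_self 2 (by omega)

/-- **Degree `< 2ⁿ` eventually**: for all large `n`, every exponent `E_{m(n)}(j)`,
`1 ≤ j ≤ 2 m(n)`, is `< 2ⁿ` (the curve has degree `2^{O((log₂ n)^{10})} = 2^{m^{o(1)}}`). -/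
theorem expo_mFn_lt :
    ∃ n₀ : ℕ, ∀ n ≥ n₀, ∀ j, 1 ≤ j → j ≤ 2 * mFn n → expo (mFn n) j < 2 ^ n := by
  obtain ⟨n₀, h₀⟩ := eventually_polylog_lt
  refine ⟨n₀, fun n hn j hj1 hj => ?_⟩
  have hlt := h₀ n hn
  set L := Nat.log 2 n
  have hB : 2 * mFn n + 2 ≤ 2 ^ (L ^ 2 + 2) := by
    unfold mFn
    have : 1 ≤ 2 ^ (L ^ 2) := Nat.one_le_two_pow
    calc 2 * 2 ^ (L ^ 2) + 2 ≤ 2 * 2 ^ (L ^ 2) + 2 * 2 ^ (L ^ 2) := by omega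
      _ = 2 ^ (L ^ 2 + 2) := by ring
  calc expo (mFn n) j
      < (2 * mFn n + 2) ^ ((Nat.log 2 (mFn n) ^ 2 + 2) * (Nat.log 2 (mFn n) ^ 2 + 1)) :=
        expo_lt (mFn n) j hj1 hj
    _ = (2 * mFn n + 2) ^ ((L ^ 4 + 2) * (L ^ 4 + 1)) := by
        rw [log_mFn, ← pow_mul]
    _ ≤ (2 ^ (L ^ 2 + 2)) ^ ((L ^ 4 + 2) * (L ^ 4 + 1)) := Nat.pow_le_pow_left hB _
    _ = 2 ^ ((L ^ 2 + 2) * ((L ^ 4 + 2) * (L ^ 4 + 1))) := by rw [← pow_mul]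
    _ < 2 ^ n := Nat.pow_lt_pow_right (by norm_num) hlt

/-- **The curve has degree `< 2ⁿ` for all large `n`.** -/
theorem totalDegree_curve_lt :
    ∃ n₀ : ℕ, ∀ n ≥ n₀, ∀ i : Fin (mFn n), (curve n i).totalDegree < 2 ^ n := by
  obtain ⟨n₀, h₀⟩ := expo_mFn_lt
  refine ⟨n₀, fun n hn i => ?_⟩
  unfold curve
  refine (totalDegree_add _ _).trans_lt (max_lt ?_ ?_)
  · rw [totalDegree_X_pow]
    exact h₀ n hn _ (by omega) (by omega)
  · rw [totalDegree_X_pow]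
    exact h₀ n hn _ (by omega) (by omega)

/-! ### Elusiveness: the hypothesis `X` in Raz's vocabulary -/

/-- The image of the curve is the route's point set `{(x^{E(2i+1)} + x^{E(2i+2)})_i : x ∈ ℂ}`. -/
theorem range_polyMapEval_curve (n : ℕ) :
    Set.range (polyMapEval (curve n)) =
      Set.range (fun x : ℂ => fun i : Fin (mFn n) =>
        x ^ expo (mFn n) (2 * i + 1) + x ^ expo (mFn n) (2 * i + 2)) := by
  ext v
  constructor
  · rintro ⟨y, rfl⟩
    exact ⟨y 0, funext fun i => by simp [polyMapEval, curve]⟩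
  · rintro ⟨x, rfl⟩
    exact ⟨fun _ => x, funext fun i => by simp [polyMapEval, curve]⟩

/-- **`X` gives eventual `(m-1, 2)`-elusiveness of the re-indexed curve** (Raz 2010,
Def. 1.1; the `Set.range ↔ IsElusive` conversion and `m(n) ≥ m₀` eventually). -/
theorem isElusive_curve
    (hX : ∃ m₀ : ℕ, ∀ m ≥ m₀, ∀ Γ : Fin m → MvPolynomial (Fin (m - 1)) ℂ,
      (∀ i, (Γ i).totalDegree ≤ 2) →
        ¬ (Set.range (fun x : ℂ => fun i : Fin m =>
              x ^ expo m (2 * i + 1) + x ^ expo m (2 * i + 2)) ⊆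
            Set.range (fun y : Fin (m - 1) → ℂ => fun i : Fin m => MvPolynomial.eval y (Γ i)))) :
    ∃ n₀ : ℕ, ∀ n ≥ n₀, IsElusive (curve n) (mFn n - 1) 2 := by
  obtain ⟨m₀, hm₀⟩ := hX
  obtain ⟨n₁, hn₁⟩ := mFn_growth 1
  refine ⟨max n₁ m₀, fun n hn => ?_⟩
  have hmn : m₀ ≤ mFn n :=
    (le_of_max_le_right hn).trans (by simpa using hn₁ n (le_of_max_le_left hn))
  intro Γ hΓ hsub
  refine hm₀ (mFn n) hmn Γ hΓ ?_
  rw [range_polyMapEval_curve] at hsub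
  exact hsub

/-! ### Explicitness: the multilinearised curve is poly(`n`)-definable -/

/-- `multilinearize` summed over any finite set containing the support. -/
theorem multilinearize_eq_sum_of_subset {k : Type*} [CommSemiring k] (n : ℕ)
    (p : MvPolynomial (Fin 1) k) {S : Finset (Fin 1 →₀ ℕ)} (hS : p.support ⊆ S) :
    multilinearize n p = ∑ d ∈ S, C (coeff d p) * multilinMonomial n (d 0) := by
  unfold multilinearize
  refine Finset.sum_subset hS fun d _ hd => ?_
  rw [notMem_support_iff.1 hd, C_0, zero_mul]

/-- `multilinearize` is additive (Raz 2010, §1.4: `f ↦ f̂` is linear). -/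
theorem multilinearize_add {k : Type*} [CommSemiring k] (n : ℕ) (p q : MvPolynomial (Fin 1) k) :
    multilinearize n (p + q) = multilinearize n p + multilinearize n q := by
  classical
  rw [multilinearize_eq_sum_of_subset n (p + q) support_add,
    multilinearize_eq_sum_of_subset n p Finset.subset_union_left,
    multilinearize_eq_sum_of_subset n q Finset.subset_union_right, ← Finset.sum_add_distrib]
  refine Finset.sum_congr rfl fun d _ => ?_
  rw [coeff_add, C_add, add_mul]

/-- `multilinearize (x^e) = ∏_{j<n, bit_j(e)=1} x_j` (Raz 2010, §1.4). -/
theorem multilinearize_X_pow {k : Type*} [CommSemiring k] [Nontrivial k] (n e : ℕ) :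
    multilinearize n ((X 0 : MvPolynomial (Fin 1) k) ^ e) = multilinMonomial n e := by
  classical
  unfold multilinearize
  rw [X_pow_eq_monomial, support_monomial, if_neg one_ne_zero, Finset.sum_singleton,
    coeff_monomial, if_pos rfl, C_1, one_mul, Finsupp.single_eq_same]

/-- The bit monomial is the selected monomial of the bit vector. -/
theorem multilinMonomial_eq_selMonomial {k : Type*} [CommRing k] (n e : ℕ) :
    (multilinMonomial n e : MvPolynomial (Fin n) k) = selMonomial n fun j => e.testBit j := rfl

/-- Sums over one selector bit. -/
theorem sum_fin_one_bool {A : Type*} [AddCommMonoid A] (F : (Fin 1 → Bool) → A) :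
    ∑ c : Fin 1 → Bool, F c = F (fun _ => true) + F (fun _ => false) := by
  rw [← Fintype.sum_equiv (Equiv.funUnique (Fin 1) Bool).symm (fun b => F fun _ => b) F
    (fun b => rfl), Fintype.sum_bool]

/-- The index bits read back: `ofBits (bits of i) = i` for `i < m(n) ≤ 2^{⌈log₂ m(n)⌉}`. -/
theorem ofBits_testBit_index (n : ℕ) (i : Fin (mFn n)) :
    Nat.ofBits (fun w : Fin (Nat.clog 2 (mFn n)) => (i : ℕ).testBit w) = i := by
  rw [Nat.ofBits_testBit, Nat.mod_eq_of_lt]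
  exact i.isLt.trans_le (Nat.le_pow_clog one_lt_two _)

/-- **The multilinearised curve is a sum of two selected monomials read off the exponent-bit
circuit**: `f̂_{n,i} = Σ_{c ∈ {0,1}} x^{expBits n (bits i, c)}`. -/
theorem multilinearize_curve (n : ℕ) (i : Fin (mFn n)) :
    multilinearize n (curve n i) =
      ∑ c : Fin 1 → Bool, selMonomial n (expBits n (Sum.elim (fun w => (i : ℕ).testBit w) c)) := by
  rw [sum_fin_one_bool, curve, multilinearize_add, multilinearize_X_pow, multilinearize_X_pow,
    multilinMonomial_eq_selMonomial, multilinMonomial_eq_selMonomial, add_comm]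
  congr 2 <;> funext l <;>
    simp only [expBits, lowBits, Sum.elim_inl, Sum.elim_inr, ofBits_testBit_index,
      Bool.toNat_true, Bool.toNat_false, add_zero]

/-- The size of the exponent-bit circuit is polynomial in `n`. -/
theorem isPBounded_expSize : IsPBounded fun n => expSize (mFn n) n := by
  have hb : IsPBounded fun n => 2400 * (n ^ 4 + 1) * (n + 1) ^ 2 :=
    IsPBounded.mul_holds (IsPBounded.mul_holds (IsPBounded.const 2400)
      (IsPBounded.add_holds (IsPBounded.pow_holds IsPBounded.id 4) (IsPBounded.const 1)))
      (IsPBounded.pow_holds (IsPBounded.add_holds IsPBounded.id (IsPBounded.const 1)) 2)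
  refine hb.mono fun n => (expSize_le (mFn n) n).trans ?_
  rw [log_mFn, ← pow_mul]
  have hL : Nat.log 2 n ^ (2 * 2) ≤ n ^ 4 := Nat.pow_le_pow_left (Nat.log_le_self 2 n) 4
  gcongr

/-- **The multilinearised binomial curve is poly(`n`)-definable** (Raz 2010, Def. 1.3, via
Valiant's criterion for mappings and the exponent-bit circuit). -/
theorem isPolyDefinableMap_curve :
    IsPolyDefinableMap (m := mFn) (σ := fun n => Fin n)
      (fun n i => multilinearize n (curve n i)) :=
  isPolyDefinableMap_of_cktSize (k := ℂ) (t := fun _ => 1) (s := fun n => expSize (mFn n) n)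
    expBits (fun _ => Nat.one_pos) (fun n => cktSize_lowBits_expo (mFn n) n _) isPBounded_expSize
    (IsPBounded.const 1) _ fun n i => multilinearize_curve n i

/-! ### Assembly -/

/-- **The bridge `X → per ∉ VP_ℂ`** with the candidate stated through `expo`: Raz 2010,
abstract / §1 result 1 (`Raz2010_elusive_curve_holds ℂ`), applied to the re-indexed binomial
curve. -/
theorem not_isVPFamily_perPoly_of_candidate
    (hX : ∃ m₀ : ℕ, ∀ m ≥ m₀, ∀ Γ : Fin m → MvPolynomial (Fin (m - 1)) ℂ,
      (∀ i, (Γ i).totalDegree ≤ 2) →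
        ¬ (Set.range (fun x : ℂ => fun i : Fin m =>
              x ^ expo m (2 * i + 1) + x ^ expo m (2 * i + 2)) ⊆
            Set.range (fun y : Fin (m - 1) → ℂ => fun i : Fin m => MvPolynomial.eval y (Γ i)))) :
    ¬ IsVPFamily (k := ℂ) (fun n => perPoly (Fin n) ℂ) :=
  Raz2010_elusive_curve.not_isVPFamily_complex (Raz2010_elusive_curve_holds ℂ) (m := mFn)
    (f := curve) mFn_growth totalDegree_curve_lt isPolyDefinableMap_curve (isElusive_curve hX)

end BinomialElusiveRazTransfer

/-- **`RazTransfer` (route `BinomialElusive`, item stmt-ValiantsHypothesis-8497).** The binomial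
candidate `X` implies `per ∉ VP_ℂ`: Raz 2010, abstract and §1 result 1 (proved in the tree,
`Raz2010_elusive_curve_holds`), with the re-indexing `m(n) = 2^{⌊log₂ n⌋²}`, the
`Set.range ↔ IsElusive` conversion, the degree bound `< 2ⁿ`, and the poly(`n`)-definability
(Def. 1.3) of the multilinearised binomial family by Valiant's criterion and a polynomial-size
exponent-bit circuit. -/
theorem RazTransfer_proof :
    Summit.ValiantsHypothesis.ValiantsHypothesis.Theses.BinomialElusive.RazTransfer := by
  unfold Summit.ValiantsHypothesis.ValiantsHypothesis.Theses.BinomialElusive.RazTransfer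
  intro hX
  exact BinomialElusiveRazTransfer.not_isVPFamily_perPoly_of_candidate hX

end Summit.ValiantsHypothesis.ValiantsHypothesis.Theorems
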